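import Mathlib
import Literature.Analysis.FluidPDE.SelfSimilarEulerProfile
import Literature.Analysis.FluidPDE.WholeSpaceIBP
import Literature.Analysis.FluidPDE.SverakLandauConformalCalc
import Summits.NavierStokesRegularity.NavierStokesRegularity.Theorems.EulerZoomLiouvillePowerGaugeEulerLiouvilleNeedleLogisticLaw
import Summits.NavierStokesRegularity.NavierStokesRegularity.Theorems.EulerZoomLiouvillePowerGaugeEulerLiouvilleSelfSimilarPastProfileEquations
import HarnessLib

/-!
# The similarity-Bernoulli transport law IN THE WEAK CLASS, I: tools
# (crux `EulerZoomLiouville.PowerGaugeEulerLiouville` = stmt-NavierStokesRegularity-19832, line `birth`)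

Width seat `ns-ezl-w1` (g6) under the crux LEAD, cell ns-regularity-ideate.  TOOL for the genuinely weak
exactly-self-similar stratum (open stub `stub_selfSimilarWeakRest`).

For a `C²` self-similar Euler profile `(V, P)` with exponent `γ` (Constantin–Ignatova–Vicol (3.3)), the
similarity field `W = γy + V` (`selfSimilarTransport γ 0 V`) and the self-similar Bernoulli function
`ℋ = ½|W|² + P + ½γ(γ−1)|y|²` (`selfSimilarBernoulli γ 0 V P`) satisfy the transport identity (3.31)
`W·∇ℋ = (2γ−1)|W|²`, equivalently — with `div W = 3γ` — `div(ℋW) = 3γℋ − (1−2γ)|W|²`.  Every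
Bernoulli-high-set argument of the lineage (piercing, channels, squeeze, «jets must turn») starts here, and
so far it was available only for classical profiles (Lagrangian `…SimilarityBernoulli`, pointwise
`IsSelfSimilarEulerProfile.fderiv_selfSimilarBernoulli_transport`).  This chain of three files
(`…WeakBernoulliTransportTools` / `…WeakBernoulliTransport` / `…WeakBernoulliTransportMember`) proves it in
the sense of distributions for profiles WITHOUT ANY REGULARITY, from exactly the three weak identities the
lineage has transferred to the profile of a weak class member (`Past.profileData_of_past`): for every test
function `θ`,

  `∫ ℋ ⟪W, ∇θ⟫ = −3γ ∫ θ ℋ + (1 − 2γ) ∫ θ |W|²`,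

given (E) the profile local energy EQUALITY, (M) the weak profile equation tested with the vector field
`ψ = θ·y`, and (W) weak incompressibility in the form `∫⟪W, ∇φ⟫ = −3γ∫φ` tested with `φ = θ|y|²`, for
`V ∈ L⁶_loc`, `P ∈ L^{3/2}_loc` (the class data); pointwise the target integrand is
`−½·(E) + γ·(M) + ½γ(2γ−1)·(W)`.

THIS FILE (tools): pointwise algebra of `W`, `ℋ`, `|W|²` about the origin (reusing `Logistic.inner_selfSimilarTransport_left`,
`Sverak2011.divergence_id_three`, `inner_gradient_eq_fderiv_apply`); `D(θ|·|²)`; `∫⟪y, ∇φ⟫ = −3∫φ`; **`WeakBernoulli.integral_inner_transport_gradient` — `div W = 3γ` in the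
weak class: `∫⟪γy + V, ∇φ⟫ = −3γ∫φ`** for `V ∈ L¹_loc` weakly divergence free; local integrability from
`L⁶` on balls.

WHAT THIS IS NOT: not NS, not E, not the stub — a weak-class TOOL (`--supports` stmt-19832).
[folklore; cf. ConstantinIgnatovaVicol2026Putative §3.4.3 (3.31)]
-/

noncomputable section

set_option linter.dupNamespace false

open MeasureTheory Set Filter Topology Metric Function TopologicalSpace
open scoped ENNReal NNReal RealInnerProductSpace ContDiff

namespace Summit.NavierStokesRegularity.NavierStokesRegularity.Theorems.PowerGaugeEulerLiouville

open Literature.Analysis Literature.Analysis.FunctionSpaces Literature.Analysis.FluidPDE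

namespace WeakBernoulli

/-! ## Pointwise algebra -/

section Pointwise

/-- `‖γy + v‖² = γ²‖y‖² + 2γ⟪v, y⟫ + ‖v‖²`. [folklore] -/
theorem norm_smul_add_sq (γ : ℝ) (y v : EuclideanSpace ℝ (Fin 3)) :
    ‖γ • y + v‖ ^ 2 = γ ^ 2 * ‖y‖ ^ 2 + 2 * γ * ⟪v, y⟫ + ‖v‖ ^ 2 := by
  rw [norm_add_sq_real, norm_smul, mul_pow, Real.norm_eq_abs, sq_abs, real_inner_smul_left,
    real_inner_comm v y]
  ring

/-- The similarity field about the origin: `W(y) = γy + V(y)`. [folklore] -/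
theorem transport_zero_apply (γ : ℝ) (V : EuclideanSpace ℝ (Fin 3) → EuclideanSpace ℝ (Fin 3))
    (y : EuclideanSpace ℝ (Fin 3)) : selfSimilarTransport γ 0 V y = γ • y + V y := by
  rw [selfSimilarTransport_apply, sub_zero]

/-- The similarity Bernoulli function about the origin, expanded:
`ℋ(y) = ½‖V‖² + γ⟪V, y⟫ + P + ½γ(2γ−1)‖y‖²`. [folklore] -/
theorem bernoulli_zero_apply (γ : ℝ) (V : EuclideanSpace ℝ (Fin 3) → EuclideanSpace ℝ (Fin 3))
    (P : EuclideanSpace ℝ (Fin 3) → ℝ) (y : EuclideanSpace ℝ (Fin 3)) :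
    selfSimilarBernoulli γ 0 V P y =
      (1 / 2 : ℝ) * ‖V y‖ ^ 2 + γ * ⟪V y, y⟫ + P y + γ * (2 * γ - 1) / 2 * ‖y‖ ^ 2 := by
  rw [selfSimilarBernoulli_apply, sub_zero, norm_smul_add_sq]
  ring

/-- `‖W(y)‖² = γ²‖y‖² + 2γ⟪V, y⟫ + ‖V‖²` about the origin. [folklore] -/
theorem norm_transport_zero_sq (γ : ℝ) (V : EuclideanSpace ℝ (Fin 3) → EuclideanSpace ℝ (Fin 3))
    (y : EuclideanSpace ℝ (Fin 3)) :
    ‖selfSimilarTransport γ 0 V y‖ ^ 2 = γ ^ 2 * ‖y‖ ^ 2 + 2 * γ * ⟪V y, y⟫ + ‖V y‖ ^ 2 := by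
  rw [transport_zero_apply, norm_smul_add_sq]

/-- The derivative of `y ↦ θ(y)‖y‖²`: `D(θ‖·‖²)(x) a = ‖x‖² Dθ(x) a + 2θ(x)⟪x, a⟫`. [folklore] -/
theorem fderiv_mul_normSq_apply {θ : EuclideanSpace ℝ (Fin 3) → ℝ} (hθ : Differentiable ℝ θ)
    (x a : EuclideanSpace ℝ (Fin 3)) :
    fderiv ℝ (fun y => θ y * ‖y‖ ^ 2) x a = ‖x‖ ^ 2 * fderiv ℝ θ x a + 2 * θ x * ⟪x, a⟫ := by
  have h1 : HasFDerivAt (fun y : EuclideanSpace ℝ (Fin 3) => ‖y‖ ^ 2) (2 • innerSL ℝ x) x :=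
    (hasStrictFDerivAt_norm_sq x).hasFDerivAt
  have h2 : HasFDerivAt θ (fderiv ℝ θ x) x := (hθ x).hasFDerivAt
  rw [show (fun y : EuclideanSpace ℝ (Fin 3) => θ y * ‖y‖ ^ 2) = θ * (fun y => ‖y‖ ^ 2) from rfl,
    (h2.mul h1).fderiv]
  simp only [_root_.add_apply, _root_.smul_apply, smul_eq_mul, innerSL_apply_apply, nsmul_eq_mul, Nat.cast_ofNat]
  ring

/-- `⟪a, W⟫ = γ⟪a, y⟫ + ⟪a, V⟫` about the origin. [folklore] -/
theorem inner_transport_zero_right (γ : ℝ) (V : EuclideanSpace ℝ (Fin 3) → EuclideanSpace ℝ (Fin 3))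
    (a y : EuclideanSpace ℝ (Fin 3)) :
    ⟪a, selfSimilarTransport γ 0 V y⟫ = γ * ⟪a, y⟫ + ⟪a, V y⟫ := by
  rw [transport_zero_apply, inner_add_right, real_inner_smul_right]

end Pointwise

/-! ## The weak divergence identity `div W = 3γ` -/

section WeakDiv

variable {V : EuclideanSpace ℝ (Fin 3) → EuclideanSpace ℝ (Fin 3)}

/-- `∫ ⟪y, ∇φ⟫ = −3 ∫ φ` for a test function `φ` (`div y = 3`, no boundary term). [folklore] -/
theorem integral_inner_id_gradient {φ : EuclideanSpace ℝ (Fin 3) → ℝ}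
    (hφ : IsTestFunctionOn (⊤ : Opens (EuclideanSpace ℝ (Fin 3))) φ) :
    ∫ y, ⟪y, gradient φ y⟫ = -3 * ∫ y, φ y := by
  have hφ1 : ContDiff ℝ 1 φ := hφ.contDiff.of_le (by exact_mod_cast le_top)
  have h := integral_mul_divergence_add_eq_zero_left (u := fun x : EuclideanSpace ℝ (Fin 3) => x) hφ1
    contDiff_id hφ.hasCompactSupport
  simp_rw [Sverak2011.divergence_id_three] at h
  rw [integral_mul_const] at h
  linarith

/-- **`div W = 3γ` in the weak class.**  For `V ∈ L¹_loc` weakly divergence free and every test function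
`φ`: `∫ ⟪γy + V(y), ∇φ(y)⟫ dy = −3γ ∫ φ`. [folklore] -/
theorem integral_inner_transport_gradient {γ : ℝ} (hV : LocallyIntegrable V volume)
    (hdiv : IsWeaklyDivFree V) {φ : EuclideanSpace ℝ (Fin 3) → ℝ}
    (hφ : IsTestFunctionOn (⊤ : Opens (EuclideanSpace ℝ (Fin 3))) φ) :
    ∫ y, ⟪selfSimilarTransport γ 0 V y, gradient φ y⟫ = -(3 * γ) * ∫ y, φ y := by
  have hφc : Continuous φ := hφ.contDiff.continuous
  have hgc : Continuous (gradient φ) :=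
    continuous_gradient_of_contDiff (hφ.contDiff.of_le (by exact_mod_cast le_top))
  have hK : IsCompact (tsupport φ) := hφ.hasCompactSupport
  have hg0 : ∀ y, y ∉ tsupport φ → gradient φ y = 0 := fun y hy => gradient_eq_zero_of_notMem_tsupport hy
  -- integrability of the two pieces
  have hi1 : Integrable (fun y : EuclideanSpace ℝ (Fin 3) => γ * ⟪y, gradient φ y⟫) volume := by
    refine ((continuous_id.inner hgc).integrable_of_hasCompactSupport ?_).const_mul γ
    exact HasCompactSupport.intro hK fun y hy => by simp [hg0 y hy]
  have hi2 : Integrable (fun y => ⟪V y, gradient φ y⟫) volume := by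
    obtain ⟨C, hC⟩ := hgc.bounded_above_of_compact_support
      (HasCompactSupport.intro hK fun y hy => hg0 y hy)
    refine ProfileEnergy.integrable_of_abs_le_on hK.measurableSet (hV.aestronglyMeasurable.inner
      hgc.aestronglyMeasurable) (hV.integrableOn_isCompact hK).norm (C := C) (fun y _ => ?_)
      (fun y hy => by rw [hg0 y hy, inner_zero_right])
    rw [abs_norm]  -- `|‖V y‖| = ‖V y‖`
    calc |⟪V y, gradient φ y⟫| ≤ ‖V y‖ * ‖gradient φ y‖ := abs_real_inner_le_norm _ _
      _ ≤ C * ‖V y‖ := by rw [mul_comm]; exact mul_le_mul_of_nonneg_right (hC y) (norm_nonneg _)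
  have e : ∀ y, ⟪selfSimilarTransport γ 0 V y, gradient φ y⟫ =
      γ * ⟪y, gradient φ y⟫ + ⟪V y, gradient φ y⟫ := fun y => Logistic.inner_selfSimilarTransport_left γ V y _
  simp_rw [e]
  rw [integral_add hi1 hi2, integral_const_mul, integral_inner_id_gradient hφ, hdiv φ hφ]
  ring

end WeakDiv

/-! ## Local integrability from the class data -/

section LocInt

variable {V : EuclideanSpace ℝ (Fin 3) → EuclideanSpace ℝ (Fin 3)}

/-- `V ∈ L⁶(B_r)` for every `r` makes `V` locally integrable. [folklore] -/
theorem locallyIntegrable_of_memLp_six_ball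
    (hV6 : ∀ r : ℝ, MemLp V 6 (volume.restrict (ball (0 : EuclideanSpace ℝ (Fin 3)) r))) :
    LocallyIntegrable V volume := by
  intro x
  refine ⟨ball 0 (‖x‖ + 1), isOpen_ball.mem_nhds (by rw [mem_ball, dist_zero_right]; linarith), ?_⟩
  haveI : IsFiniteMeasure ((volume : Measure (EuclideanSpace ℝ (Fin 3))).restrict (ball 0 (‖x‖ + 1))) :=
    isFiniteMeasure_restrict.2 measure_ball_lt_top.ne
  exact memLp_one_iff_integrable.1 ((hV6 (‖x‖ + 1)).mono_exponent (by norm_num))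

end LocInt

end WeakBernoulli

end Summit.NavierStokesRegularity.NavierStokesRegularity.Theorems.PowerGaugeEulerLiouville
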